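import Literature.NumberTheory.EllipticCurves.CasselsTateLemma615
import Literature.NumberTheory.GaloisRepresentations.ContinuousH3
import HarnessLib

/-!
# The general case of the Cassels–Tate pairing at level `m`: the local cocycle over a `K`-field

Topic `NumberTheory/EllipticCurves`; namespace `Literature.NumberTheory.EllipticCurves`. Definitions with
bodies and theorems only: **no named fact is introduced** (D-0026).

Milne's definition of the Cassels–Tate pairing (*ADT* I, proof of Prop. 6.9, GENERAL case, p. 79 of the
second edition): for `a ∈ Ш(E/K)[m]`, `a' ∈ Ш(E/K)[m]` choose Selmer lifts `b, b' ∈ H¹(K, E[m])` with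
cocycle representatives `β, β'`, a continuous cochain `β₁ ∈ C¹(Γ_K, E[m²])` with `[m] ∘ β₁ = β`, so that
`dβ₁ = ι ∘ f` for a `2`-cocycle `f ∈ Z²(Γ_K, E[m])`, and a `2`-cochain `ε ∈ C²(Γ_K, μ_{m²})` with
`dε = f ∪ β'`; at each place `v` choose a local Kummer cocycle `β_{v,1} ∈ Z¹(Γ_v, E[m²])` (a cocycle of a
point of `E(K_v)`) lifting `β_v`. Then `(β_{1,v} - β_{v,1}) ∪ β'_{v,1} - ε_v` is a `2`-cocycle of
`μ_{m²}` over `K_v` and `⟨a, a'⟩ = ∑_v inv_v [(β_{1,v} - β_{v,1}) ∪ β'_{v,1} - ε_v]`.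

This file constructs that LOCAL `2`-cocycle over an arbitrary `K`-field `E` (a completion `K_v`) from the
restricted global cochains and a local Kummer cocycle, and proves the local halves of "independent of
the choices" and "bi-additive". Two simplifications of the printed construction, both exact (no change
of the value):

* the local Kummer cocycle `κ = β_{v,1}` is chosen with `[m] ∘ κ = [m] ∘ β_{1,v}` ON THE NOSE (not only up
  to a coboundary: the coboundary is absorbed into the choice of the root of the point, see
  `exists_localKummerCocycle_eq` — every cocycle whose class lies in the local Kummer condition IS a local
  Kummer cocycle), so Milne's footnote-14 correction of `ε_v` is not needed;
* the cup product is taken through the DESCENDED pairing `E[m] × E[m] → μ_{m²}`,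
  `(S, T) ↦ e_{m²}(ι S, T̃)` (`descendPairing`, file `WeilPairingLevelDescent`): with
  `α⁰ = ι⁻¹ ∘ (β_{1,v} - κ) ∈ C¹(Γ_v, E[m])` one has `(β_{1,v} - κ) ∪_{m²} β'_{v,1} = α⁰ ∪_desc β'_v`
  pointwise (`e_{m²}(ι S, T̃) = desc(S, [m] T̃)`), and `d(α⁰ ∪_desc β'_v) = f_v ∪_desc β'_v = dε_v`
  (`dα⁰ = f_v`, `β'_v` a cocycle), so `z_v = α⁰ ∪_desc β'_v - ε_v` is the tree's
  `ContPairing.cupSubCocycle` (file `ContinuousH3`) and no local lift of `β'` is needed either.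

## Main statements

* `levelDown W m` (`ι⁻¹` on `E[m²][m]`, extended by `0`) and its cochain version;
* `exists_localKummerCocycle_eq` (cocycle-level exactness of the local Kummer sequence),
  `exists_kummerLift` (a local Kummer cocycle `κ` at level `m²` with `[m] ∘ κ = ψ` prescribed);
* `GeneralLocalData` (the restricted global cochains `β₁, f, β', ε` with their two identities and a local
  Kummer cocycle `κ`), `GeneralLocalData.cocycle` (Milne's local `2`-cocycle `z_v`) and
  `GeneralLocalData.term inv_E = inv_E [z_v]`;
* `term_eq_of_kummer` — **independence of the local Kummer cocycle** (two choices differ by `ι ∘ g₀` with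
  `[g₀] ∈ 𝓛_E^{(m)}`, changing `z_v` by `g₀ ∪_desc β'_v`, killed by `inv_E` by the isotropy of `𝓛_E`);
* `term_add_left`, `term_add_right` (additivity), `cocycle_eq_of_eps_add` (change of `ε` by a
  `2`-cocycle), `cocycle_eq_of_add_incl` (change of `β₁` by `ι ∘ γ`), `cocycle_congr`;
* `twoCocycleClass_cocycle_of_mem` — **the first case**: if `β₁` is a cocycle and `ε` a cocycle then
  `[z_v] = (res b₁ - [κ]) ∪_{m²} β'_{v,1} - [ε_v]` for any local lift `β'_{v,1}` of `β'_v`, i.e. the local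
  term is the tree's `ctLocalTerm` minus `inv_E [ε_v]`;
* `twoCocycleClass_cocycle_of_lift_right` — **the divisible second variable**: if `β' = [m] ∘ β'₁` for a
  local Kummer cocycle `β'₁` at level `m²`, then `[z_v] = [β₁ ∪_{m²} β'₁ - ε]_v - [κ] ∪_{m²} [β'₁]`, the
  last term killed by `inv_E` (isotropy at level `m²`).

The global sum, its finiteness and independence of `ε` (reciprocity for `H²(K, μ_{m²})`), of `β₁, b, b'`,
the agreement with `ctFirstCaseFun` and the vanishing on `mШ` are the sequel. Motivation: provefact
`WeierstrassCurve.exists_casselsTate_pairing`.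

## References

* [MilneADT2006] J. S. Milne, *Arithmetic Duality Theorems*, 2nd ed. (2006), Ch. I §6, proof of
  Prop. 6.9 (general case, p. 79, with footnote 14), Rem. 6.10–6.12.
* [PoonenStoll1999] B. Poonen, M. Stoll, *The Cassels–Tate pairing on polarized abelian varieties*,
  Ann. of Math. 150 (1999), §3 ("the Weil-pairing definition"), for the same cochain construction.
-/

noncomputable section

open scoped Classical

universe u

namespace Literature.NumberTheory.EllipticCurves

open CategoryTheory _root_.WeierstrassCurve Field Function
open Literature.NumberTheory.GaloisRepresentations Literature.NumberTheory.GaloisCohomology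
open Literature.NumberTheory.GaloisRepresentations.DiscreteGaloisModule (mu MuCarrier pairing)
open scoped ContRepresentation

-- Cup products need `LocallyCompactSpace Γ`; as in the tree's cup-product files, the compactness of
-- absolute Galois groups is a local instance only.
attribute [local instance] absoluteGaloisGroup_compactSpace


/-! ## `ι⁻¹` on `E[m²][m]` -/

section LevelDown

variable {K : Type u} [Field K] (W : WeierstrassCurve K) (m : ℕ)

/-- `ι` commutes with the Galois action. [folklore] -/
theorem inclKD_smul (σ : absoluteGaloisGroup K) (S : geomTorsion W (m : ℤ)) :
    inclKD W m m (σ • S) = σ • inclKD W m m S :=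
  Subtype.ext rfl

/-- `[m] (ι S) = 0`. [folklore] -/
theorem mulK_inclKD (S : geomTorsion W (m : ℤ)) : mulK W m m (inclKD W m m S) = 0 :=
  Subtype.ext (by rw [coe_mulK_apply, coe_inclKD_apply]; exact (mem_geomTorsion_iff W (m : ℤ) _).1 S.2)

/-- `ι` is injective (same underlying point). [folklore] -/
theorem inclKD_injective : Injective (inclKD W m m) := fun S T h =>
  Subtype.ext (by rw [← coe_inclKD_apply W m m S, h, coe_inclKD_apply])

/-- **`ι⁻¹ : E[m²][m] → E[m]`, extended by `0`**: a point of `E[m²]` killed by `m` IS a point of `E[m]`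
(same underlying point of `E(K̄)`); on the other points of `E[m²]` the value is `0`. [folklore] -/
def levelDown (S' : geomTorsion W ((m * m : ℕ) : ℤ)) : geomTorsion W (m : ℤ) :=
  if h : (m : ℤ) • (S' : geomPoints W) = 0 then ⟨S', (mem_geomTorsion_iff W (m : ℤ) _).2 h⟩ else 0

/-- `ι (ι⁻¹ S') = S'` when `[m] S' = 0`. [folklore] -/
theorem inclKD_levelDown {S' : geomTorsion W ((m * m : ℕ) : ℤ)} (h : mulK W m m S' = 0) :
    inclKD W m m (levelDown W m S') = S' := by
  have h' : (m : ℤ) • (S' : geomPoints W) = 0 := by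
    rw [← coe_mulK_apply, h]; rfl
  apply Subtype.ext
  rw [coe_inclKD_apply, levelDown, dif_pos h']

/-- `ι⁻¹ (ι S) = S`. [folklore] -/
@[simp]
theorem levelDown_inclKD (S : geomTorsion W (m : ℤ)) : levelDown W m (inclKD W m m S) = S := by
  have h' : (m : ℤ) • ((inclKD W m m S : geomTorsion W ((m * m : ℕ) : ℤ)) : geomPoints W) = 0 := by
    rw [coe_inclKD_apply]; exact (mem_geomTorsion_iff W (m : ℤ) _).1 S.2
  apply Subtype.ext
  rw [levelDown, dif_pos h']
  exact coe_inclKD_apply W m m S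

/-- `ι⁻¹` is additive on `E[m²][m]`. [folklore] -/
theorem levelDown_add {S' T' : geomTorsion W ((m * m : ℕ) : ℤ)} (hS : mulK W m m S' = 0)
    (hT : mulK W m m T' = 0) : levelDown W m (S' + T') = levelDown W m S' + levelDown W m T' :=
  inclKD_injective W m (by rw [map_add, inclKD_levelDown W m hS, inclKD_levelDown W m hT,
    inclKD_levelDown W m (by rw [map_add, hS, hT, add_zero])])

/-- `ι⁻¹` commutes with subtraction on `E[m²][m]`. [folklore] -/
theorem levelDown_sub {S' T' : geomTorsion W ((m * m : ℕ) : ℤ)} (hS : mulK W m m S' = 0)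
    (hT : mulK W m m T' = 0) : levelDown W m (S' - T') = levelDown W m S' - levelDown W m T' :=
  inclKD_injective W m (by rw [map_sub, inclKD_levelDown W m hS, inclKD_levelDown W m hT,
    inclKD_levelDown W m (by rw [map_sub, hS, hT, sub_zero])])

/-- `ι⁻¹` as a continuous map of the discrete modules. [folklore] -/
def levelDownMap : C(geomTorsion W ((m * m : ℕ) : ℤ), geomTorsion W (m : ℤ)) :=
  ⟨levelDown W m, continuous_of_discreteTopology⟩

/-- Unfolding `levelDownMap`. [folklore] -/
@[simp]
theorem levelDownMap_apply (S' : geomTorsion W ((m * m : ℕ) : ℤ)) : levelDownMap W m S' = levelDown W m S' := rfl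

end LevelDown

/-! ## Restricting global cochains and cocycles to `Γ_E`; typed classes -/

section Res

variable {K : Type u} [Field K] {M : Type u} [AddCommGroup M] [TopologicalSpace M] [DiscreteTopology M]
variable (ρ : DiscreteGaloisModule K M) (E : Type u) [Field E] [Algebra K E]

omit [AddCommGroup M] [DiscreteTopology M] in
/-- Restriction of a continuous `1`-cochain of `Γ_K` to `Γ_E` (composition with `Γ_E → Γ_K`). [folklore] -/
def resCochain₁ (α : C(absoluteGaloisGroup K, M)) : C(absoluteGaloisGroup E, M) :=
  α.comp (absGaloisRestrict K E : C(absoluteGaloisGroup E, absoluteGaloisGroup K))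

omit [AddCommGroup M] [DiscreteTopology M] in
/-- Restriction of a continuous `2`-cochain of `Γ_K` to `Γ_E`. [folklore] -/
def resCochain₂ (ε : C(absoluteGaloisGroup K × absoluteGaloisGroup K, M)) :
    C(absoluteGaloisGroup E × absoluteGaloisGroup E, M) :=
  ε.comp ((absGaloisRestrict K E : C(absoluteGaloisGroup E, absoluteGaloisGroup K)).prodMap
    (absGaloisRestrict K E : C(absoluteGaloisGroup E, absoluteGaloisGroup K)))

/-- Restriction of a continuous `1`-cocycle of `M` to `Γ_E` (values in the restricted module
`M|_{Γ_E}`; the tree's `contOneCocycles.pullback` along `absGaloisRestrict K E`). [folklore] -/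
def resOne (g : contOneCocycles ρ.toTopRep) :
    contOneCocycles (DiscreteGaloisModule.toTopRep (GaloisRep.restrictField E ρ)) :=
  contOneCocycles.pullback (absGaloisRestrict K E) (X := ρ.toTopRep)
    (Y := DiscreteGaloisModule.toTopRep (GaloisRep.restrictField E ρ))
    (TopRep.ofHom ⟨ContinuousLinearMap.id ℤ M, fun _ => rfl⟩) g

/-- Restriction of a continuous `2`-cocycle of `M` to `Γ_E`. [folklore] -/
def resTwo (f : contTwoCocycles ρ.toTopRep) :
    contTwoCocycles (DiscreteGaloisModule.toTopRep (GaloisRep.restrictField E ρ)) :=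
  contTwoCocycles.pullback (absGaloisRestrict K E) (X := ρ.toTopRep)
    (Y := DiscreteGaloisModule.toTopRep (GaloisRep.restrictField E ρ))
    (TopRep.ofHom ⟨ContinuousLinearMap.id ℤ M, fun _ => rfl⟩) f

/-- Restriction of a continuous `3`-cocycle of `M` to `Γ_E`. [folklore] -/
def resThree (z : contThreeCocycles ρ.toTopRep) :
    contThreeCocycles (DiscreteGaloisModule.toTopRep (GaloisRep.restrictField E ρ)) :=
  contThreeCocycles.pullback (absGaloisRestrict K E) (X := ρ.toTopRep)
    (Y := DiscreteGaloisModule.toTopRep (GaloisRep.restrictField E ρ))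
    (TopRep.ofHom ⟨ContinuousLinearMap.id ℤ M, fun _ => rfl⟩) z

omit [AddCommGroup M] [DiscreteTopology M] in
/-- Unfolding `resCochain₁`. [folklore] -/
@[simp]
theorem resCochain₁_apply (α : C(absoluteGaloisGroup K, M)) (σ : absoluteGaloisGroup E) :
    resCochain₁ E α σ = α (absGaloisRestrict K E σ) := rfl

omit [AddCommGroup M] [DiscreteTopology M] in
/-- Unfolding `resCochain₂`. [folklore] -/
@[simp]
theorem resCochain₂_apply (ε : C(absoluteGaloisGroup K × absoluteGaloisGroup K, M)) (σ τ : absoluteGaloisGroup E) :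
    resCochain₂ E ε (σ, τ) = ε (absGaloisRestrict K E σ, absGaloisRestrict K E τ) := rfl

/-- Unfolding `resOne`. [folklore] -/
@[simp]
theorem resOne_apply (g : contOneCocycles ρ.toTopRep) (σ : absoluteGaloisGroup E) :
    (resOne ρ E g).1 σ = g.1 (absGaloisRestrict K E σ) := rfl

/-- Unfolding `resTwo`. [folklore] -/
@[simp]
theorem resTwo_apply (f : contTwoCocycles ρ.toTopRep) (σ τ : absoluteGaloisGroup E) :
    (resTwo ρ E f).1 (σ, τ) = f.1 (absGaloisRestrict K E σ, absGaloisRestrict K E τ) := rfl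

/-- Unfolding `resThree`. [folklore] -/
@[simp]
theorem resThree_apply (z : contThreeCocycles ρ.toTopRep) (σ τ υ : absoluteGaloisGroup E) :
    (resThree ρ E z).1 (σ, τ, υ) = z.1 (absGaloisRestrict K E σ, absGaloisRestrict K E τ, absGaloisRestrict K E υ) :=
  rfl

/-- **The class of a local `1`-cocycle, typed in `galoisCohomology`** (`H¹(Γ_E, M)` of the restricted module):
a synonym of `oneCocycleClass`, so that membership in local conditions (subgroups of
`galoisCohomology (M|_{Γ_E}) 1`) and the local pairings (defined on `galoisCohomology`) apply to it
verbatim. [folklore] -/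
def locClass (ψ : contOneCocycles (DiscreteGaloisModule.toTopRep (GaloisRep.restrictField E ρ))) :
    galoisCohomology (GaloisRep.restrictField E ρ) 1 :=
  oneCocycleClass _ ψ

/-- **The class of a local `2`-cocycle, typed in `galoisCohomology`.** [folklore] -/
def locClass₂ (z : contTwoCocycles (DiscreteGaloisModule.toTopRep (GaloisRep.restrictField E ρ))) :
    galoisCohomology (GaloisRep.restrictField E ρ) 2 :=
  twoCocycleClass _ z

/-- `locClass` is `oneCocycleClass`. [folklore] -/
theorem locClass_eq (ψ : contOneCocycles (DiscreteGaloisModule.toTopRep (GaloisRep.restrictField E ρ))) :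
    locClass ρ E ψ = oneCocycleClass _ ψ := rfl

/-- `locClass₂` is `twoCocycleClass`. [folklore] -/
theorem locClass₂_eq (z : contTwoCocycles (DiscreteGaloisModule.toTopRep (GaloisRep.restrictField E ρ))) :
    locClass₂ ρ E z = twoCocycleClass _ z := rfl

/-- Additivity of `locClass`. [folklore] -/
theorem locClass_add (ψ ψ' : contOneCocycles (DiscreteGaloisModule.toTopRep (GaloisRep.restrictField E ρ))) :
    locClass ρ E (ψ + ψ') = locClass ρ E ψ + locClass ρ E ψ' :=
  oneCocycleClass_add _ ψ ψ'

/-- `locClass` of a difference. [folklore] -/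
theorem locClass_sub (ψ ψ' : contOneCocycles (DiscreteGaloisModule.toTopRep (GaloisRep.restrictField E ρ))) :
    locClass ρ E (ψ - ψ') = locClass ρ E ψ - locClass ρ E ψ' :=
  oneCocycleClass_sub _ ψ ψ'

/-- Additivity of `locClass₂`. [folklore] -/
theorem locClass₂_add (z z' : contTwoCocycles (DiscreteGaloisModule.toTopRep (GaloisRep.restrictField E ρ))) :
    locClass₂ ρ E (z + z') = locClass₂ ρ E z + locClass₂ ρ E z' :=
  twoCocycleClass_add _ z z'

/-- `locClass₂` of a difference. [folklore] -/
theorem locClass₂_sub (z z' : contTwoCocycles (DiscreteGaloisModule.toTopRep (GaloisRep.restrictField E ρ))) :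
    locClass₂ ρ E (z - z') = locClass₂ ρ E z - locClass₂ ρ E z' :=
  twoCocycleClass_sub _ z z'

/-- `locClass₂ 0 = 0`. [folklore] -/
@[simp]
theorem locClass₂_zero :
    locClass₂ ρ E (0 : contTwoCocycles (DiscreteGaloisModule.toTopRep (GaloisRep.restrictField E ρ))) = 0 :=
  twoCocycleClass_zero _

/-- A principal crossed homomorphism has class `0`. [folklore] -/
theorem locClass_eq_zero_of_principal
    (ψ : contOneCocycles (DiscreteGaloisModule.toTopRep (GaloisRep.restrictField E ρ))) (x : M)
    (h : ∀ σ, ψ.1 σ = ρ (absGaloisRestrict K E σ) x - x) : locClass ρ E ψ = 0 :=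
  (oneCocycleClass_eq_zero_iff _ ψ).2 ⟨x, h⟩

/-- `[res g] = res_E [g]` on `H¹`. [folklore] -/
theorem locClass_resOne (g : contOneCocycles ρ.toTopRep) :
    locClass ρ E (resOne ρ E g) = galoisCohomology.res ρ E 1 (oneCocycleClass _ g) :=
  (galoisCohomology.res_one_oneCocycleClass E g).symm

/-- `[res f] = res_E [f]` on `H²`. [folklore] -/
theorem locClass₂_resTwo (f : contTwoCocycles ρ.toTopRep) :
    locClass₂ ρ E (resTwo ρ E f) = galoisCohomology.res ρ E 2 (twoCocycleClass _ f) :=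
  (map_twoCocycleClass (absGaloisRestrict K E) (X := ρ.toTopRep)
    (Y := DiscreteGaloisModule.toTopRep (GaloisRep.restrictField E ρ))
    (TopRep.ofHom ⟨ContinuousLinearMap.id ℤ M, fun _ => rfl⟩) f).symm

/-- `[res z] = res_E [z]` on `H³`. [folklore] -/
theorem threeCocycleClass_resThree (z : contThreeCocycles ρ.toTopRep) :
    threeCocycleClass _ (resThree ρ E z) = galoisCohomology.res ρ E 3 (threeCocycleClass _ z) :=
  (map_threeCocycleClass (absGaloisRestrict K E) (X := ρ.toTopRep)
    (Y := DiscreteGaloisModule.toTopRep (GaloisRep.restrictField E ρ))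
    (TopRep.ofHom ⟨ContinuousLinearMap.id ℤ M, fun _ => rfl⟩) z).symm

/-- The push-forward of a local cocycle along an intertwining map, and its class:
`H¹(f|_{Γ_E}) [ψ] = [f ∘ ψ]`. [folklore] -/
theorem map_restrictField_locClass {N : Type u} [AddCommGroup N] [TopologicalSpace N] [DiscreteTopology N]
    {ρ' : DiscreteGaloisModule K N} (f : ρ.toContRepresentation →ⁱL ρ'.toContRepresentation)
    (ψ : contOneCocycles (DiscreteGaloisModule.toTopRep (GaloisRep.restrictField E ρ))) :
    galoisCohomology.map (f.restrictField E) 1 (locClass ρ E ψ) =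
      locClass ρ' E (contOneCocycles.pullback (ContinuousMonoidHom.id (absoluteGaloisGroup E))
        (X := DiscreteGaloisModule.toTopRep (GaloisRep.restrictField E ρ))
        (Y := DiscreteGaloisModule.toTopRep (GaloisRep.restrictField E ρ'))
        (TopRep.ofHom ⟨(f.restrictField E).toContinuousLinearMap, (f.restrictField E).isIntertwining'⟩) ψ) :=
  galoisCohomology.map_one_oneCocycleClass (f.restrictField E) ψ

end Res

/-! ## Local Kummer cocycles: cocycle-level exactness and lifting along `[m]` -/

section Kummer

variable {K : Type u} [Field K] [CharZero K] (W : WeierstrassCurve K) [W.IsElliptic]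
variable (E : Type u) [Field E] [Algebra K E]

/-- **Cocycle-level exactness of the local Kummer sequence.** A continuous crossed homomorphism
`ψ : Γ_E → E[n](K̄)` whose CLASS lies in the local Kummer condition `𝓛_E^{(n)}` is itself, on the nose,
the local Kummer cocycle `σ ↦ θ⁻¹(σ • Q - Q)` of a point `Q ∈ E(K̄_E)` with `n • Q ∈ E(E)`: if
`pointsMap ∘ ψ` is the coboundary `σ ↦ σ • Q - Q` of `Q` in `E(K̄_E)` then `n • Q` is `Γ_E`-fixed and
`ψ = κ_Q` (this is the proof of the tree's `exists_eq_localKummerClass_of_mem`). It lets the local Kummer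
lift `β_{v,1}` of Milne's construction be chosen with `[m] ∘ β_{v,1} = β_v` EXACTLY (the coboundary by
which two representatives differ is absorbed into the root). Silverman, *AEC*, VIII.§2, X.§4; Milne,
*ADT*, I.§6, proof of Prop. 6.9 ("`b_v = δ_v(P_v)`"). [cite: MilneADT2006, Ch. I §6, proof of Prop. 6.9] -/
theorem exists_localKummerCocycle_eq {n : ℤ} (hn : n ≠ 0)
    (ψ : contOneCocycles
      (DiscreteGaloisModule.toTopRep (GaloisRep.restrictField E (W.torsionGaloisModule n))))
    (hψ : locClass (W.torsionGaloisModule n) E ψ ∈ W.kummerLocalConditionAt n E) :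
    ∃ (Q : localPoints W E)
      (hQ : n • Q ∈ MulAction.fixedPoints (absoluteGaloisGroup E) (localPoints W E)),
      ψ = W.localKummerCocycle n hn Q hQ := by
  have h1 := (W.mem_kummerLocalConditionAt_iff n E _).1 hψ
  rw [locClass_eq, map_torsionPointsMapIntertwining_oneCocycleClass] at h1
  obtain ⟨Q, hQ⟩ := (oneCocycleClass_eq_zero_iff _ _).mp h1
  have hQ' : ∀ σ : absoluteGaloisGroup E, pointsMap W E (ψ.1 σ : geomTorsion W n) = σ • Q - Q :=
    hQ
  have hfix : n • Q ∈ MulAction.fixedPoints (absoluteGaloisGroup E) (localPoints W E) := by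
    intro σ
    have h0 : n • (σ • Q - Q) = 0 := by
      rw [← hQ' σ, ← map_zsmul]
      have : n • ((ψ.1 σ : geomTorsion W n) : geomPoints W) = 0 :=
        (mem_geomTorsion_iff W n _).mp (ψ.1 σ).2
      rw [this, map_zero]
    rw [zsmul_sub, ← smul_zsmul_localPoints, sub_eq_zero] at h0
    exact h0
  refine ⟨Q, hfix, Subtype.ext (ContinuousMap.ext fun σ => ?_)⟩
  apply (W.torsionPointsEquiv n (E := E) hn).injective
  apply Subtype.ext
  change pointsMap W E (ψ.1 σ : geomTorsion W n) =
    ((W.torsionPointsEquiv n (E := E) hn) ((W.torsionPointsEquiv n (E := E) hn).symm _) :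
      localPoints W E)
  rw [AddEquiv.apply_symm_apply]
  exact hQ' σ

variable (m : ℕ) [NeZero m]

/-- **Local Kummer lifts along `[m]` with prescribed values**: for a cocycle `ψ : Γ_E → E[m](K̄)` whose
class lies in `𝓛_E^{(m)}` there is a local Kummer cocycle `κ : Γ_E → E[m²](K̄)` (its class in
`𝓛_E^{(m²)}`) with `[m] ∘ κ = ψ` exactly: write `ψ = κ_Q` (`exists_localKummerCocycle_eq`), divide
`Q = m Q₁` in `E(K̄_E)` and take `κ = κ_{Q₁}`; then `[m] θ⁻¹(σ Q₁ - Q₁) = θ⁻¹(σ Q - Q)`. This is Milne's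
`b_{v,1}` ("a lift to `H¹(G_v, A_{m²})` that is in the image of `A(K_v)`") chosen at cocycle level.
[cite: MilneADT2006, Ch. I §6, proof of Prop. 6.9] -/
theorem exists_kummerLift
    (ψ : contOneCocycles
      (DiscreteGaloisModule.toTopRep (GaloisRep.restrictField E (W.torsionGaloisModule (m : ℤ)))))
    (hψ : locClass (W.torsionGaloisModule (m : ℤ)) E ψ ∈ W.kummerLocalConditionAt (m : ℤ) E) :
    ∃ κ : contOneCocycles (DiscreteGaloisModule.toTopRep
        (GaloisRep.restrictField E (W.torsionGaloisModule ((m * m : ℕ) : ℤ)))),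
      locClass (W.torsionGaloisModule ((m * m : ℕ) : ℤ)) E κ ∈ W.kummerLocalConditionAt ((m * m : ℕ) : ℤ) E ∧
        ∀ σ, mulK W m m (κ.1 σ) = ψ.1 σ := by
  have hm : (m : ℤ) ≠ 0 := Int.natCast_ne_zero.mpr (NeZero.ne m)
  have hmm : ((m * m : ℕ) : ℤ) ≠ 0 := Int.natCast_ne_zero.mpr (NeZero.ne (m * m))
  obtain ⟨Q, hQ, rfl⟩ := exists_localKummerCocycle_eq W E hm ψ hψ
  obtain ⟨Q₁, hQ₁⟩ : ∃ Q₁ : localPoints W E, (m : ℤ) • Q₁ = Q :=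
    (W.baseChange (AlgebraicClosure E)).zsmul_surjective_of_isAlgClosed hm Q
  have hfix : ((m * m : ℕ) : ℤ) • Q₁ ∈ MulAction.fixedPoints (absoluteGaloisGroup E) (localPoints W E) := by
    rw [Nat.cast_mul, mul_zsmul, hQ₁]
    exact hQ
  refine ⟨W.localKummerCocycle _ hmm Q₁ hfix,
    W.localKummerClass_mem_kummerLocalConditionAt _ hmm Q₁ hfix, fun σ => ?_⟩
  have h := (W.torsionPointsEquiv_symm_zsmul (m : ℤ) (m : ℤ) (mul_ne_zero hm hm) hm
    ⟨σ • Q₁ - Q₁, smul_sub_mem_torsionBy_localPoints hfix σ⟩).symm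
  refine h.trans ?_
  change (W.torsionPointsEquiv (m : ℤ) (E := E) hm).symm _ =
    (W.torsionPointsEquiv (m : ℤ) (E := E) hm).symm ⟨σ • Q - Q, _⟩
  congr 1
  apply Subtype.ext
  change (m : ℤ) • (σ • Q₁ - Q₁) = σ • Q - Q
  rw [zsmul_sub, ← smul_zsmul_localPoints, hQ₁]

omit [CharZero K] [W.IsElliptic] [NeZero m] in
/-- **`ι_*⁻¹(𝓛_E^{(m²)}) ⊆ 𝓛_E^{(m)}`**: a class `x ∈ H¹(E, E[m])` whose image under `ι_*` satisfies the
local Kummer condition at level `m²` satisfies it at level `m` (both conditions are "dies in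
`H¹(Γ_E, E(K̄_E))`", and `E[m] ↪ E[m²] → E(K̄_E)` is `E[m] → E(K̄_E)`). [folklore] -/
theorem mem_kummerLocalConditionAt_of_map_inclKD_mem
    {x : galoisCohomology (GaloisRep.restrictField E (W.torsionGaloisModule (m : ℤ))) 1}
    (hx : galoisCohomology.map ((inclKD W m m).restrictField E) 1 x ∈
      W.kummerLocalConditionAt ((m * m : ℕ) : ℤ) E) :
    x ∈ W.kummerLocalConditionAt (m : ℤ) E := by
  obtain ⟨ψ, rfl⟩ := oneCocycleClass_surjective _ x
  have h1 := (W.mem_kummerLocalConditionAt_iff _ E _).1 hx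
  rw [galoisCohomology.map_one_oneCocycleClass, map_torsionPointsMapIntertwining_oneCocycleClass] at h1
  refine (W.mem_kummerLocalConditionAt_iff _ E _).2 ?_
  rw [map_torsionPointsMapIntertwining_oneCocycleClass, ← h1]
  exact congrArg _ (Subtype.ext (ContinuousMap.ext fun σ => rfl))

/-- `ι_*` maps `𝓛_E^{(m)}` into `𝓛_E^{(m²)}` (the tree's `map_inclKD_mem_kummerLocalConditionAt` of
`CasselsTateLemma617.lean`, re-derived here to keep the imports of this file small). [folklore] -/
theorem map_inclKD_mem_kummerLocalConditionAt'
    {c : galoisCohomology (GaloisRep.restrictField E (W.torsionGaloisModule (m : ℤ))) 1}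
    (hc : c ∈ W.kummerLocalConditionAt (m : ℤ) E) :
    galoisCohomology.map ((inclKD W m m).restrictField E) 1 c ∈ W.kummerLocalConditionAt ((m * m : ℕ) : ℤ) E := by
  have hm : (m : ℤ) ≠ 0 := Int.natCast_ne_zero.mpr (NeZero.ne m)
  have hmm : ((m * m : ℕ) : ℤ) ≠ 0 := Int.natCast_ne_zero.mpr (NeZero.ne (m * m))
  obtain ⟨Q, hQ, rfl⟩ := W.exists_eq_localKummerClass_of_mem (m : ℤ) hm hc
  have hQ' : ((m * m : ℕ) : ℤ) • Q ∈ MulAction.fixedPoints (absoluteGaloisGroup E) (localPoints W E) := by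
    intro σ
    rw [Nat.cast_mul, mul_zsmul, smul_zsmul_localPoints, hQ σ]
  rw [W.map_torsionInclusion_localKummerClass _ hm hmm Q hQ hQ']
  exact W.localKummerClass_mem_kummerLocalConditionAt _ hmm Q hQ'

end Kummer

/-! ## The local datum and Milne's local `2`-cocycle -/

section Local

variable {K : Type u} [Field K] [NumberField K] (W : WeierstrassCurve K) (m : ℕ) [NeZero m]
variable (E : Type u) [Field E] [Algebra K E]

/-- `E[n](K̄)|_{Γ_E}` as a topological representation of `Γ_E` (the `TopRep` underlying the restricted
module `GaloisRep.restrictField E (W.torsionGaloisModule n)`). [folklore] -/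
abbrev torsionRepAt (n : ℤ) : TopRep.{u} ℤ (absoluteGaloisGroup E) :=
  DiscreteGaloisModule.toTopRep (GaloisRep.restrictField E (W.torsionGaloisModule n))

/-- `μ_{m²}|_{Γ_E}` as a topological representation of `Γ_E`. [folklore] -/
abbrev muRepAt : TopRep.{u} ℤ (absoluteGaloisGroup E) :=
  DiscreteGaloisModule.toTopRep (GaloisRep.restrictField E (mu K (m * m)))

omit [NumberField K] [NeZero m] in
/-- The action of `Γ_E` on `E[n](K̄)|_{Γ_E}` is through `Γ_E → Γ_K`. [folklore] -/
theorem torsionRepAt_ρ_apply (n : ℤ) (σ : absoluteGaloisGroup E) (S : geomTorsion W n) :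
    (torsionRepAt W E n).ρ σ S = absGaloisRestrict K E σ • S := rfl

omit [NumberField K] [NeZero m] in
/-- The action of `Γ_E` on `μ_{m²}|_{Γ_E}` is through `Γ_E → Γ_K`. [folklore] -/
theorem muRepAt_ρ_apply (σ : absoluteGaloisGroup E) (x : MuCarrier K (m * m)) :
    (muRepAt (K := K) m E).ρ σ x = mu K (m * m) (absGaloisRestrict K E σ) x := rfl

variable (e : geomTorsion W ((m * m : ℕ) : ℤ) → geomTorsion W ((m * m : ℕ) : ℤ) → AlgebraicClosure K)
  (hμ : ∀ S T, e S T ^ (m * m) = 1)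
  (hadd₁ : ∀ S₁ S₂ T, e (S₁ + S₂) T = e S₁ T * e S₂ T)
  (hadd₂ : ∀ S T₁ T₂, e S (T₁ + T₂) = e S T₁ * e S T₂)
  (hgal : ∀ (σ : absoluteGaloisGroup K) (S T : geomTorsion W ((m * m : ℕ) : ℤ)),
    σ • e S T = e (σ • S) (σ • T))

/-! ### Typed local cup products -/

/-- **The cup product `2`-cocycle `g₀ ∪_desc g`** of two local `1`-cocycles of `E[m]` through the descended
pairing `E[m] × E[m] → μ_{m²}` (typed on `μ_{m²}|_{Γ_E}`). [folklore] -/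
def descCup (g₀ g : contOneCocycles (torsionRepAt W E (m : ℤ))) : contTwoCocycles (muRepAt (K := K) m E) :=
  ((descendPairing W m m e hμ hadd₁ hadd₂ hgal).restrict (absGaloisRestrict K E)).cupCocycle g₀ g

/-- Values of `descCup`. [folklore] -/
@[simp]
theorem descCup_apply (g₀ g : contOneCocycles (torsionRepAt W E (m : ℤ))) (σ τ : absoluteGaloisGroup E) :
    (descCup W m E e hμ hadd₁ hadd₂ hgal g₀ g).1 (σ, τ) =
      descendHom W m m e hμ hadd₁ hadd₂ (g₀.1 σ) (g.1 (σ * τ) - g.1 σ) :=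
  rfl

/-- `[g₀ ∪_desc g] = [g₀] ∪_desc [g]` (the tree's `descLocalCup`). [folklore] -/
theorem locClass₂_descCup (g₀ g : contOneCocycles (torsionRepAt W E (m : ℤ))) :
    locClass₂ (mu K (m * m)) E (descCup W m E e hμ hadd₁ hadd₂ hgal g₀ g) =
      descLocalCup W m e hμ hadd₁ hadd₂ hgal E (locClass _ E g₀) (locClass _ E g) := by
  rw [descLocalCup_apply]
  exact (ContPairing.cupProduct_oneCocycleClass_eq_twoCocycleClass _ g₀ g).symm

/-- **The cochain cup product `γ ∪_desc g`** of a local `1`-cochain with a local `1`-cocycle of `E[m]`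
(typed on `μ_{m²}|_{Γ_E}`). [folklore] -/
def descCochainCup (γ : C(absoluteGaloisGroup E, torsionRepAt W E (m : ℤ)))
    (g : contOneCocycles (torsionRepAt W E (m : ℤ))) :
    C(absoluteGaloisGroup E × absoluteGaloisGroup E, muRepAt (K := K) m E) :=
  ((descendPairing W m m e hμ hadd₁ hadd₂ hgal).restrict (absGaloisRestrict K E)).cochainCup₁₁ γ g

/-- Values of `descCochainCup`. [folklore] -/
@[simp]
theorem descCochainCup_apply (γ : C(absoluteGaloisGroup E, torsionRepAt W E (m : ℤ)))
    (g : contOneCocycles (torsionRepAt W E (m : ℤ))) (σ τ : absoluteGaloisGroup E) :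
    descCochainCup W m E e hμ hadd₁ hadd₂ hgal γ g (σ, τ) = descendHom W m m e hμ hadd₁ hadd₂ (γ σ) (g.1 (σ * τ) - g.1 σ) :=
  rfl

/-- **The cup product `2`-cocycle `k ∪_{m²} k'`** of two local `1`-cocycles of `E[m²]` through the Weil
pairing at level `m²` (typed on `μ_{m²}|_{Γ_E}`). [folklore] -/
def weilCup (k k' : contOneCocycles (torsionRepAt W E ((m * m : ℕ) : ℤ))) :
    contTwoCocycles (muRepAt (K := K) m E) :=
  ((weilContPairing W (m * m) e hμ hadd₁ hadd₂ hgal).restrict (absGaloisRestrict K E)).cupCocycle k k'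

omit [NumberField K] in
/-- Values of `weilCup`. [folklore] -/
@[simp]
theorem weilCup_apply (k k' : contOneCocycles (torsionRepAt W E ((m * m : ℕ) : ℤ))) (σ τ : absoluteGaloisGroup E) :
    (weilCup W m E e hμ hadd₁ hadd₂ hgal k k').1 (σ, τ) =
      weilPairingHom W (m * m) e hμ hadd₁ hadd₂ (k.1 σ) (k'.1 (σ * τ) - k'.1 σ) :=
  rfl

omit [NumberField K] in
/-- `[k ∪_{m²} k'] = [k] ∪_{m²} [k']` (the tree's `weilLocalCup`). [folklore] -/
theorem locClass₂_weilCup (k k' : contOneCocycles (torsionRepAt W E ((m * m : ℕ) : ℤ))) :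
    locClass₂ (mu K (m * m)) E (weilCup W m E e hμ hadd₁ hadd₂ hgal k k') =
      weilLocalCup W m E e hμ hadd₁ hadd₂ hgal (locClass _ E k) (locClass _ E k') := by
  rw [weilLocalCup_apply]
  exact (ContPairing.cupProduct_oneCocycleClass_eq_twoCocycleClass _ k k').symm

/-- **The cochain cup product `β₁ ∪_{m²} k`** of a local `1`-cochain with a local `1`-cocycle of `E[m²]`
(typed on `μ_{m²}|_{Γ_E}`). [folklore] -/
def weilCochainCup (β₁ : C(absoluteGaloisGroup E, torsionRepAt W E ((m * m : ℕ) : ℤ)))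
    (k : contOneCocycles (torsionRepAt W E ((m * m : ℕ) : ℤ))) :
    C(absoluteGaloisGroup E × absoluteGaloisGroup E, muRepAt (K := K) m E) :=
  ((weilContPairing W (m * m) e hμ hadd₁ hadd₂ hgal).restrict (absGaloisRestrict K E)).cochainCup₁₁ β₁ k

omit [NumberField K] in
/-- Values of `weilCochainCup`. [folklore] -/
@[simp]
theorem weilCochainCup_apply (β₁ : C(absoluteGaloisGroup E, torsionRepAt W E ((m * m : ℕ) : ℤ)))
    (k : contOneCocycles (torsionRepAt W E ((m * m : ℕ) : ℤ))) (σ τ : absoluteGaloisGroup E) :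
    weilCochainCup W m E e hμ hadd₁ hadd₂ hgal β₁ k (σ, τ) =
      weilPairingHom W (m * m) e hμ hadd₁ hadd₂ (β₁ σ) (k.1 (σ * τ) - k.1 σ) :=
  rfl

/-! ### The structures -/

/-- **A local Kummer datum** over the `K`-field `E`: the restrictions to `Γ_E` of the continuous cochain
`β₁ ∈ C¹(Γ_K, E[m²])` lifting a cocycle `β` of the Selmer class `b` (`[m] ∘ β₁ = β`) and of the `2`-cocycle
`f ∈ Z²(Γ_K, E[m])` with `ι ∘ f = dβ₁` (`inclKD_f`), together with a LOCAL Kummer cocycle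
`κ = β_{v,1} ∈ Z¹(Γ_E, E[m²])` — its class in the local Kummer condition `𝓛_E^{(m²)}` (`κ_mem`) — lifting
`β_v` exactly: `[m] ∘ κ = [m] ∘ β₁` (`mulK_κ`; such `κ` exist by `exists_kummerLift`).
[cite: MilneADT2006, Ch. I §6, proof of Prop. 6.9] -/
structure KummerLocalData where
  /-- the restriction `β_{1,v}` of the global cochain lift `β₁ ∈ C¹(Γ_K, E[m²])` of `β` -/
  β₁ : C(absoluteGaloisGroup E, torsionRepAt W E ((m * m : ℕ) : ℤ))
  /-- the restriction `f_v` of the global `2`-cocycle `f ∈ Z²(Γ_K, E[m])` with `ι ∘ f = dβ₁` -/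
  f : contTwoCocycles (torsionRepAt W E (m : ℤ))
  inclKD_f : ∀ σ τ : absoluteGaloisGroup E,
    inclKD W m m (f.1 (σ, τ)) = absGaloisRestrict K E σ • β₁ τ - β₁ (σ * τ) + β₁ σ
  /-- the local Kummer cocycle `κ = β_{v,1} ∈ Z¹(Γ_E, E[m²])` -/
  κ : contOneCocycles (torsionRepAt W E ((m * m : ℕ) : ℤ))
  κ_mem : locClass _ E κ ∈ W.kummerLocalConditionAt ((m * m : ℕ) : ℤ) E
  mulK_κ : ∀ σ : absoluteGaloisGroup E, mulK W m m (κ.1 σ) = mulK W m m (β₁ σ)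

/-- **A local datum of the general case of the Cassels–Tate pairing at level `m` over the `K`-field `E`**
(a completion `K_v`; Milne, *ADT*, I, proof of Prop. 6.9, general case): a local Kummer datum
(`KummerLocalData`: `β_{1,v}`, `f_v`, `κ`) together with the restrictions to `Γ_E` of the cocycle `β'` of the
Selmer lift `b'` of `a'` and of the `2`-cochain `ε ∈ C²(Γ_K, μ_{m²})` with `dε = f ∪_desc β'` (`dTwo_ε`).
[cite: MilneADT2006, Ch. I §6, proof of Prop. 6.9] -/
structure GeneralLocalData extends KummerLocalData W m E where
  /-- the restriction `β'_v` of the cocycle `β'` of the Selmer lift `b'` of `a'` -/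
  β' : contOneCocycles (torsionRepAt W E (m : ℤ))
  /-- the restriction `ε_v` of the global `2`-cochain `ε ∈ C²(Γ_K, μ_{m²})` with `dε = f ∪_desc β'` -/
  ε : C(absoluteGaloisGroup E × absoluteGaloisGroup E, muRepAt (K := K) m E)
  dTwo_ε : ∀ σ τ υ : absoluteGaloisGroup E,
    (((descendPairing W m m e hμ hadd₁ hadd₂ hgal).restrict (absGaloisRestrict K E)).cupCocycle₂₁
        f β').1 (σ, τ, υ) = dTwo (muRepAt (K := K) m E) ε σ τ υ

namespace KummerLocalData

variable {W m E}
variable (D : KummerLocalData W m E)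

omit [NumberField K] [NeZero m] in
/-- `[m] (β_{1,v} σ - κ σ) = 0`. [folklore] -/
theorem mulK_sub (σ : absoluteGaloisGroup E) : mulK W m m (D.β₁ σ - D.κ.1 σ) = 0 := by
  rw [map_sub, D.mulK_κ, sub_self]

/-- **The `1`-cochain `α⁰ = ι⁻¹ ∘ (β_{1,v} - β_{v,1}) ∈ C¹(Γ_E, E[m])`** (Milne's `-c_v` read in `E[m]`:
`[m] ∘ (β_{1,v} - κ) = 0`, so the values lie in `ι E[m]`). [cite: MilneADT2006, Ch. I §6, proof of Prop. 6.9] -/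
def alpha : C(absoluteGaloisGroup E, torsionRepAt W E (m : ℤ)) :=
  (levelDownMap W m).comp (D.β₁ - D.κ.1)

omit [NumberField K] [NeZero m] in
/-- Unfolding `alpha`. [folklore] -/
@[simp]
theorem alpha_apply (σ : absoluteGaloisGroup E) : D.alpha σ = levelDown W m (D.β₁ σ - D.κ.1 σ) := rfl

omit [NumberField K] [NeZero m] in
/-- `ι (α⁰ σ) = β_{1,v} σ - κ σ`. [folklore] -/
theorem inclKD_alpha (σ : absoluteGaloisGroup E) : inclKD W m m (D.alpha σ) = D.β₁ σ - D.κ.1 σ :=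
  inclKD_levelDown W m (D.mulK_sub σ)

omit [NumberField K] [NeZero m] in
/-- **`dα⁰ = f_v`**: the coboundary of `α⁰` is the restriction of `f` (`ι ∘ dα⁰ = dβ_{1,v} - dκ = ι ∘ f_v`,
`κ` being a cocycle, and `ι` is injective). [cite: MilneADT2006, Ch. I §6, proof of Prop. 6.9] -/
theorem f_eq_dOne_alpha (σ τ : absoluteGaloisGroup E) :
    D.f.1 (σ, τ) = (torsionRepAt W E (m : ℤ)).ρ σ (D.alpha τ) - D.alpha (σ * τ) + D.alpha σ := by
  apply inclKD_injective W m
  have hκ : D.κ.1 (σ * τ) = D.κ.1 σ + absGaloisRestrict K E σ • D.κ.1 τ := D.κ.2 σ τ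
  change inclKD W m m (D.f.1 (σ, τ)) =
    inclKD W m m (absGaloisRestrict K E σ • D.alpha τ - D.alpha (σ * τ) + D.alpha σ)
  rw [map_add, map_sub, inclKD_smul, inclKD_alpha, inclKD_alpha, inclKD_alpha, D.inclKD_f, hκ, smul_sub]
  abel

/-- **The obstruction `f_v ∪_desc g` is a coboundary locally**, for every local `1`-cocycle `g` of `E[m]`:
`d(α⁰ ∪_desc g) = dα⁰ ∪ g = f_v ∪ g` (Leibniz). With `g = β'_v` this is the local triviality of the class
`[f ∪ β'] ∈ H³(K, μ_{m²})` whose global triviality (an `H³` input) produces Milne's `ε`.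
[cite: MilneADT2006, Ch. I §6, proof of Prop. 6.9] -/
theorem dTwo_descCochainCup_alpha (g : contOneCocycles (torsionRepAt W E (m : ℤ))) (σ τ υ : absoluteGaloisGroup E) :
    dTwo (muRepAt (K := K) m E) (descCochainCup W m E e hμ hadd₁ hadd₂ hgal D.alpha g) σ τ υ =
      (((descendPairing W m m e hμ hadd₁ hadd₂ hgal).restrict (absGaloisRestrict K E)).cupCocycle₂₁
        D.f g).1 (σ, τ, υ) :=
  ContPairing.dTwo_cochainCup₁₁ _ D.alpha g D.f D.f_eq_dOne_alpha σ τ υ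

/-- Hence `[f_v ∪_desc g] = 0` in `H³(Γ_E, μ_{m²})`. [cite: MilneADT2006, Ch. I §6, proof of Prop. 6.9] -/
theorem threeCocycleClass_cupCocycle₂₁_eq_zero (g : contOneCocycles (torsionRepAt W E (m : ℤ))) :
    threeCocycleClass _
        (((descendPairing W m m e hμ hadd₁ hadd₂ hgal).restrict (absGaloisRestrict K E)).cupCocycle₂₁
          D.f g) = 0 :=
  (threeCocycleClass_eq_zero_iff_dTwo _ _).2
    ⟨_, fun σ τ υ => (D.dTwo_descCochainCup_alpha e hμ hadd₁ hadd₂ hgal g σ τ υ).symm⟩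

omit [NumberField K] [NeZero m] in
/-- If `β_{1,v}` is a `1`-cocycle then `α⁰` is a `1`-cocycle. [folklore] -/
theorem alpha_mem_of_mem (hβ₁ : D.β₁ ∈ contOneCocycles (torsionRepAt W E ((m * m : ℕ) : ℤ))) :
    D.alpha ∈ contOneCocycles (torsionRepAt W E (m : ℤ)) := fun σ τ => by
  apply inclKD_injective W m
  have h₁ : D.β₁ (σ * τ) = D.β₁ σ + absGaloisRestrict K E σ • D.β₁ τ := hβ₁ σ τ
  have h₂ : D.κ.1 (σ * τ) = D.κ.1 σ + absGaloisRestrict K E σ • D.κ.1 τ := D.κ.2 σ τ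
  change inclKD W m m (D.alpha (σ * τ)) =
    inclKD W m m (D.alpha σ + absGaloisRestrict K E σ • D.alpha τ)
  rw [map_add, inclKD_smul, inclKD_alpha, inclKD_alpha, inclKD_alpha, h₁, h₂, smul_sub]
  abel

omit [NumberField K] [NeZero m] in
/-- `ι_* [α⁰] = [β_{1,v}] - [κ]` when `β_{1,v}` is a cocycle. [folklore] -/
theorem map_inclKD_locClass_alpha
    (hβ₁ : D.β₁ ∈ contOneCocycles (torsionRepAt W E ((m * m : ℕ) : ℤ))) :
    galoisCohomology.map ((inclKD W m m).restrictField E) 1 (locClass _ E ⟨D.alpha, D.alpha_mem_of_mem hβ₁⟩) =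
      locClass _ E ⟨D.β₁, hβ₁⟩ - locClass _ E D.κ := by
  rw [map_restrictField_locClass, ← locClass_sub]
  congr 1
  apply Subtype.ext
  ext σ : 1
  exact D.inclKD_alpha σ

end KummerLocalData

namespace GeneralLocalData

variable {W m E e hμ hadd₁ hadd₂ hgal}
variable (D : GeneralLocalData W m E e hμ hadd₁ hadd₂ hgal)

/-- **Milne's local `2`-cocycle `z_v = α⁰ ∪_desc β'_v - ε_v ∈ Z²(Γ_E, μ_{m²})`**
(`= (β_{1,v} - β_{v,1}) ∪_{m²} β'_{v,1} - ε_v` for any Kummer lift `β'_{v,1}` of `β'_v`; the tree's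
`ContPairing.cupSubCocycle` of `ContinuousH3.lean`, a cocycle because `d(α⁰ ∪ β') = dα⁰ ∪ β' = f ∪ β' = dε`).
[cite: MilneADT2006, Ch. I §6, proof of Prop. 6.9] -/
def cocycle : contTwoCocycles (muRepAt (K := K) m E) :=
  ((descendPairing W m m e hμ hadd₁ hadd₂ hgal).restrict (absGaloisRestrict K E)).cupSubCocycle
    D.alpha D.β' D.f D.f_eq_dOne_alpha D.ε D.dTwo_ε

/-- Values of `z_v`: `z_v(σ, τ) = desc(α⁰ σ, σ β'(τ)) - ε(σ, τ)` in the action-free form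
`desc(α⁰ σ, β'(στ) - β'(σ)) - ε(σ, τ)`. [folklore] -/
theorem cocycle_apply (σ τ : absoluteGaloisGroup E) :
    D.cocycle.1 (σ, τ) =
      descendHom W m m e hμ hadd₁ hadd₂ (levelDown W m (D.β₁ σ - D.κ.1 σ)) (D.β'.1 (σ * τ) - D.β'.1 σ) -
        D.ε (σ, τ) :=
  rfl

/-- Values of `z_v` through `α⁰`: `z_v(σ, τ) = desc(α⁰ σ, β'(στ) - β'(σ)) - ε(σ, τ)`. [folklore] -/
theorem cocycle_apply_alpha (σ τ : absoluteGaloisGroup E) :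
    D.cocycle.1 (σ, τ) =
      descendHom W m m e hμ hadd₁ hadd₂ (D.alpha σ) (D.β'.1 (σ * τ) - D.β'.1 σ) - D.ε (σ, τ) :=
  rfl

/-- **The local term** `t_v = inv_E [z_v] ∈ ℤ/m²` for an additive `inv_E : H²(Γ_E, μ_{m²}) → ℤ/m²`.
[cite: MilneADT2006, Ch. I §6, proof of Prop. 6.9] -/
def term (invE : galoisCohomology (GaloisRep.restrictField E (mu K (m * m))) 2 →+ ZMod (m * m)) :
    ZMod (m * m) :=
  invE (locClass₂ _ E D.cocycle)

/-! ### Dependence on the data: congruence, additivity, change of `ε`, of `β₁`, of `β'` -/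

/-- **`z_v` depends only on `β_{1,v} - κ`, `β'_v` and `ε_v`** (not on `f` or the proofs). [folklore] -/
theorem cocycle_congr {D D₂ : GeneralLocalData W m E e hμ hadd₁ hadd₂ hgal}
    (h₁ : ∀ σ, D.β₁ σ - D.κ.1 σ = D₂.β₁ σ - D₂.κ.1 σ) (hβ' : D.β' = D₂.β') (hε : D.ε = D₂.ε) :
    D.cocycle = D₂.cocycle :=
  Subtype.ext (ContinuousMap.ext fun p => by
    obtain ⟨σ, τ⟩ := p
    rw [cocycle_apply, cocycle_apply, h₁, hβ', hε])

/-- **Additivity in the first variable**: if `β_{1,v}`, `κ`, `ε_v` add and `β'_v` is shared then the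
cocycles add (Milne, *ADT*, I Prop. 6.9: the pairing is additive in `a`). [cite: MilneADT2006, Ch. I §6, proof of Prop. 6.9] -/
theorem cocycle_eq_add_of_left {D D₂ D₃ : GeneralLocalData W m E e hμ hadd₁ hadd₂ hgal}
    (hβ₁ : ∀ σ, D₃.β₁ σ = D.β₁ σ + D₂.β₁ σ) (hκ : ∀ σ, D₃.κ.1 σ = D.κ.1 σ + D₂.κ.1 σ)
    (hβ' : D.β' = D₃.β') (hβ'₂ : D₂.β' = D₃.β') (hε : ∀ p, D₃.ε p = D.ε p + D₂.ε p) :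
    D₃.cocycle = D.cocycle + D₂.cocycle :=
  Subtype.ext (ContinuousMap.ext fun p => by
    obtain ⟨σ, τ⟩ := p
    change D₃.cocycle.1 (σ, τ) = D.cocycle.1 (σ, τ) + D₂.cocycle.1 (σ, τ)
    rw [cocycle_apply, cocycle_apply, cocycle_apply, hβ₁, hκ, hε, hβ'₂, ← hβ',
      show D.β₁ σ + D₂.β₁ σ - (D.κ.1 σ + D₂.κ.1 σ) = (D.β₁ σ - D.κ.1 σ) + (D₂.β₁ σ - D₂.κ.1 σ) by abel,
      levelDown_add W m (D.mulK_sub σ) (D₂.mulK_sub σ), map_add, AddMonoidHom.add_apply]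
    abel)

/-- **Additivity in the second variable**: if `β'_v`, `ε_v` add and `β_{1,v}`, `κ` are shared then the
cocycles add (Milne, *ADT*, I Prop. 6.9: the pairing is additive in `a'`). [cite: MilneADT2006, Ch. I §6, proof of Prop. 6.9] -/
theorem cocycle_eq_add_of_right {D D₂ D₃ : GeneralLocalData W m E e hμ hadd₁ hadd₂ hgal}
    (hβ₁ : D.β₁ = D₃.β₁) (hβ₁₂ : D₂.β₁ = D₃.β₁) (hκ : D.κ = D₃.κ) (hκ₂ : D₂.κ = D₃.κ)
    (hβ' : ∀ σ, D₃.β'.1 σ = D.β'.1 σ + D₂.β'.1 σ) (hε : ∀ p, D₃.ε p = D.ε p + D₂.ε p) :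
    D₃.cocycle = D.cocycle + D₂.cocycle :=
  Subtype.ext (ContinuousMap.ext fun p => by
    obtain ⟨σ, τ⟩ := p
    change D₃.cocycle.1 (σ, τ) = D.cocycle.1 (σ, τ) + D₂.cocycle.1 (σ, τ)
    rw [cocycle_apply, cocycle_apply, cocycle_apply, hβ', hβ', hε, hβ₁₂, ← hβ₁, hκ₂, ← hκ,
      show D.β'.1 (σ * τ) + D₂.β'.1 (σ * τ) - (D.β'.1 σ + D₂.β'.1 σ) =
        (D.β'.1 (σ * τ) - D.β'.1 σ) + (D₂.β'.1 (σ * τ) - D₂.β'.1 σ) by abel, map_add]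
    abel)

/-- **Changing `ε_v` by a `2`-cocycle `c` subtracts `c`** (two choices of `ε` with `dε = f ∪ β'` differ by
a global `2`-cocycle). [cite: MilneADT2006, Ch. I §6, proof of Prop. 6.9] -/
theorem cocycle_eq_sub_of_eps {D D₂ : GeneralLocalData W m E e hμ hadd₁ hadd₂ hgal}
    (c : contTwoCocycles (muRepAt (K := K) m E))
    (hβ₁ : D.β₁ = D₂.β₁) (hκ : D.κ = D₂.κ) (hβ' : D.β' = D₂.β') (hε : ∀ p, D₂.ε p = D.ε p + c.1 p) :
    D₂.cocycle = D.cocycle - c :=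
  Subtype.ext (ContinuousMap.ext fun p => by
    obtain ⟨σ, τ⟩ := p
    change D₂.cocycle.1 (σ, τ) = D.cocycle.1 (σ, τ) - c.1 (σ, τ)
    rw [cocycle_apply, cocycle_apply, hε, hβ₁, hκ, hβ']
    abel)

/-- On local terms: `t_v(ε + c) = t_v(ε) - inv_E [c]`. [folklore] -/
theorem term_eq_sub_of_eps {D D₂ : GeneralLocalData W m E e hμ hadd₁ hadd₂ hgal}
    (invE : galoisCohomology (GaloisRep.restrictField E (mu K (m * m))) 2 →+ ZMod (m * m))
    (c : contTwoCocycles (muRepAt (K := K) m E))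
    (hβ₁ : D.β₁ = D₂.β₁) (hκ : D.κ = D₂.κ) (hβ' : D.β' = D₂.β') (hε : ∀ p, D₂.ε p = D.ε p + c.1 p) :
    D₂.term invE = D.term invE - invE (locClass₂ _ E c) := by
  rw [term, term, cocycle_eq_sub_of_eps c hβ₁ hκ hβ' hε, locClass₂_sub, map_sub]

/-- **Changing the cochain lift `β₁` by `ι ∘ γ` does not change `z_v`**: if `β₁ ↦ β₁ + ι ∘ γ` for a
`1`-cochain `γ` of `E[m]` (so `f ↦ f + dγ`) and accordingly `ε ↦ ε + γ ∪_desc β'`, with the same `κ`,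
then `α⁰ ↦ α⁰ + γ` and `(α⁰ + γ) ∪ β' - (ε + γ ∪ β') = α⁰ ∪ β' - ε`.
[cite: MilneADT2006, Ch. I §6, proof of Prop. 6.9] -/
theorem cocycle_eq_of_add_incl {D D₂ : GeneralLocalData W m E e hμ hadd₁ hadd₂ hgal}
    (γ : C(absoluteGaloisGroup E, torsionRepAt W E (m : ℤ)))
    (hβ₁ : ∀ σ, D₂.β₁ σ = D.β₁ σ + inclKD W m m (γ σ)) (hκ : D.κ = D₂.κ) (hβ' : D.β' = D₂.β')
    (hε : ∀ p, D₂.ε p = D.ε p + descCochainCup W m E e hμ hadd₁ hadd₂ hgal γ D.β' p) :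
    D₂.cocycle = D.cocycle :=
  Subtype.ext (ContinuousMap.ext fun p => by
    obtain ⟨σ, τ⟩ := p
    have hsplit : D.β₁ σ + inclKD W m m (γ σ) - D.κ.1 σ = (D.β₁ σ - D.κ.1 σ) + inclKD W m m (γ σ) := by
      abel
    rw [cocycle_apply, cocycle_apply, hε, hβ₁, ← hκ, ← hβ', hsplit,
      levelDown_add W m (D.mulK_sub σ) (mulK_inclKD W m (γ σ)), levelDown_inclKD, map_add,
      AddMonoidHom.add_apply, descCochainCup_apply]
    abel)

/-- **Changing `β'` within its class does not change `[z_v]`**: if `β'_v ↦ β'_v + (σ ↦ σ T' - T')`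
(a coboundary, `T' ∈ E[m]`) and accordingly `ε_v ↦ ε_v + η_v` with `η(σ, τ) = desc(f_v(σ, τ), στ T')` — the
`2`-cochain with `dη = f ∪ dT'` — then `z_v` changes by the coboundary of `σ ↦ -desc(α⁰ σ, σ T')`.
[cite: MilneADT2006, Ch. I §6, proof of Prop. 6.9] -/
theorem locClass₂_cocycle_eq_of_cobd {D D₂ : GeneralLocalData W m E e hμ hadd₁ hadd₂ hgal}
    (T' : geomTorsion W (m : ℤ)) (hβ₁ : D.β₁ = D₂.β₁) (hκ : D.κ = D₂.κ)
    (hβ' : ∀ σ, D₂.β'.1 σ = D.β'.1 σ + (absGaloisRestrict K E σ • T' - T'))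
    (hε : ∀ σ τ, D₂.ε (σ, τ) = D.ε (σ, τ) +
      descendHom W m m e hμ hadd₁ hadd₂ (D.f.1 (σ, τ)) (absGaloisRestrict K E (σ * τ) • T')) :
    locClass₂ _ E D₂.cocycle = locClass₂ _ E D.cocycle := by
  rw [← sub_eq_zero, ← locClass₂_sub]
  have hcont : Continuous fun σ : absoluteGaloisGroup E =>
      -descendHom W m m e hμ hadd₁ hadd₂ (D.alpha σ) (absGaloisRestrict K E σ • T') :=
    (((descendPairing W m m e hμ hadd₁ hadd₂ hgal).restrict (absGaloisRestrict K E)).continuous_toLin_comp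
      D.alpha.continuous ((W.torsionGaloisModule (m : ℤ)).continuous_apply₂.comp
        ((map_continuous (absGaloisRestrict K E)).prodMk continuous_const))).neg
  refine (twoCocycleClass_eq_zero_iff _ (D₂.cocycle - D.cocycle)).2 ⟨⟨_, hcont⟩, fun σ τ => ?_⟩
  change D₂.cocycle.1 (σ, τ) - D.cocycle.1 (σ, τ) =
    mu K (m * m) (absGaloisRestrict K E σ)
        (-descendHom W m m e hμ hadd₁ hadd₂ (D.alpha τ) (absGaloisRestrict K E τ • T')) -
      -descendHom W m m e hμ hadd₁ hadd₂ (D.alpha (σ * τ)) (absGaloisRestrict K E (σ * τ) • T') +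
      -descendHom W m m e hμ hadd₁ hadd₂ (D.alpha σ) (absGaloisRestrict K E σ • T')
  have hα : ∀ ν, D₂.alpha ν = D.alpha ν := fun ν => by
    rw [KummerLocalData.alpha_apply, KummerLocalData.alpha_apply]
    change levelDown W m (D₂.β₁ ν - D₂.κ.1 ν) = levelDown W m (D.β₁ ν - D.κ.1 ν)
    rw [← hβ₁, ← hκ]
  rw [map_neg, ← descendHom_smul W m m e hμ hadd₁ hadd₂ hgal, ← mul_smul, ← map_mul, cocycle_apply_alpha,
    cocycle_apply_alpha, hα, hε, hβ', hβ', D.f_eq_dOne_alpha σ τ, torsionRepAt_ρ_apply]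
  simp only [map_add, map_sub, AddMonoidHom.add_apply, AddMonoidHom.sub_apply]
  abel

/-! ### Independence of the local Kummer cocycle -/

/-- The difference of two local Kummer cocycles at level `m²` with the same image under `[m]`, read in
`E[m]`: the `1`-cocycle `g₀ = ι⁻¹ ∘ (κ - κ₂)` of `E[m]|_{Γ_E}`. [folklore] -/
def kummerDiff (D D₂ : GeneralLocalData W m E e hμ hadd₁ hadd₂ hgal) (hβ₁ : D.β₁ = D₂.β₁) :
    contOneCocycles (torsionRepAt W E (m : ℤ)) :=
  ⟨(levelDownMap W m).comp (D.κ.1 - D₂.κ.1),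
    fun σ τ => by
      have hz : ∀ ν, mulK W m m (D.κ.1 ν - D₂.κ.1 ν) = 0 := fun ν => by
        rw [map_sub, D.mulK_κ, D₂.mulK_κ, hβ₁, sub_self]
      apply inclKD_injective W m
      change inclKD W m m (levelDown W m (D.κ.1 (σ * τ) - D₂.κ.1 (σ * τ))) =
        inclKD W m m (levelDown W m (D.κ.1 σ - D₂.κ.1 σ) +
          absGaloisRestrict K E σ • levelDown W m (D.κ.1 τ - D₂.κ.1 τ))
      have h₁ : D.κ.1 (σ * τ) = D.κ.1 σ + absGaloisRestrict K E σ • D.κ.1 τ := D.κ.2 σ τ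
      have h₂ : D₂.κ.1 (σ * τ) = D₂.κ.1 σ + absGaloisRestrict K E σ • D₂.κ.1 τ := D₂.κ.2 σ τ
      rw [map_add, inclKD_smul, inclKD_levelDown W m (hz _), inclKD_levelDown W m (hz _),
        inclKD_levelDown W m (hz _), h₁, h₂, smul_sub]
      abel⟩

/-- Values of `kummerDiff`. [folklore] -/
@[simp]
theorem kummerDiff_apply {D D₂ : GeneralLocalData W m E e hμ hadd₁ hadd₂ hgal} (hβ₁ : D.β₁ = D₂.β₁)
    (σ : absoluteGaloisGroup E) : (kummerDiff D D₂ hβ₁).1 σ = levelDown W m (D.κ.1 σ - D₂.κ.1 σ) :=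
  rfl

/-- `ι_* [g₀] = [κ] - [κ₂]`. [folklore] -/
theorem map_inclKD_locClass_kummerDiff {D D₂ : GeneralLocalData W m E e hμ hadd₁ hadd₂ hgal}
    (hβ₁ : D.β₁ = D₂.β₁) :
    galoisCohomology.map ((inclKD W m m).restrictField E) 1 (locClass _ E (kummerDiff D D₂ hβ₁)) =
      locClass _ E D.κ - locClass _ E D₂.κ := by
  rw [map_restrictField_locClass, ← locClass_sub]
  congr 1
  apply Subtype.ext
  ext σ : 1
  have hz : mulK W m m (D.κ.1 σ - D₂.κ.1 σ) = 0 := by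
    rw [map_sub, D.mulK_κ, D₂.mulK_κ, hβ₁, sub_self]
  change inclKD W m m (levelDown W m (D.κ.1 σ - D₂.κ.1 σ)) = D.κ.1 σ - D₂.κ.1 σ
  exact inclKD_levelDown W m hz

/-- **`[g₀] ∈ 𝓛_E^{(m)}`**: the difference class of two local Kummer cocycles lies in the local Kummer
condition at level `m` (`ι_* [g₀] = [κ] - [κ₂] ∈ 𝓛_E^{(m²)}`). [folklore] -/
theorem locClass_kummerDiff_mem {D D₂ : GeneralLocalData W m E e hμ hadd₁ hadd₂ hgal}
    (hβ₁ : D.β₁ = D₂.β₁) :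
    locClass _ E (kummerDiff D D₂ hβ₁) ∈ W.kummerLocalConditionAt (m : ℤ) E :=
  mem_kummerLocalConditionAt_of_map_inclKD_mem W E m (by
    rw [map_inclKD_locClass_kummerDiff hβ₁]
    exact sub_mem D.κ_mem D₂.κ_mem)

/-- **Two local Kummer cocycles change `z_v` by a cup product of cocycles**:
`z_v(κ₂) = z_v(κ) + g₀ ∪_desc β'_v` with `g₀ = ι⁻¹ ∘ (κ - κ₂)`. [cite: MilneADT2006, Ch. I §6, proof of Prop. 6.9] -/
theorem cocycle_eq_add_descCup_kummerDiff {D D₂ : GeneralLocalData W m E e hμ hadd₁ hadd₂ hgal}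
    (hβ₁ : D.β₁ = D₂.β₁) (hβ' : D.β' = D₂.β') (hε : D.ε = D₂.ε) :
    D₂.cocycle = D.cocycle + descCup W m E e hμ hadd₁ hadd₂ hgal (kummerDiff D D₂ hβ₁) D.β' :=
  Subtype.ext (ContinuousMap.ext fun p => by
    obtain ⟨σ, τ⟩ := p
    change D₂.cocycle.1 (σ, τ) = D.cocycle.1 (σ, τ) + (descCup W m E e hμ hadd₁ hadd₂ hgal _ _).1 (σ, τ)
    have hsplit : D₂.β₁ σ - D₂.κ.1 σ = (D.β₁ σ - D.κ.1 σ) + (D.κ.1 σ - D₂.κ.1 σ) := by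
      rw [hβ₁]; abel
    have hz : mulK W m m (D.κ.1 σ - D₂.κ.1 σ) = 0 := by
      rw [map_sub, D.mulK_κ, D₂.mulK_κ, hβ₁, sub_self]
    rw [cocycle_apply, cocycle_apply, hsplit, levelDown_add W m (D.mulK_sub σ) hz, map_add,
      AddMonoidHom.add_apply, descCup_apply, kummerDiff_apply, ← hβ', ← hε]
    abel)

/-- The isotropy of `𝓛_E^{(m)}` for `∪_desc` (the named isotropy fact of `KummerImageIsotropy.lean` is
discharged in the tree: `kummerClass_cupProduct_kummerClass_eq_zero_holds`). [cite: PoonenRains2012, Prop. 4.8 and Cor. 4.6] -/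
theorem descLocalCup_eq_zero_of_mem_of_mem [W.IsElliptic] [CharZero E] (halt : ∀ T, e T T = 1)
    ⦃x y : galoisCohomology (GaloisRep.restrictField E (W.torsionGaloisModule (m : ℤ))) 1⦄
    (hx : x ∈ W.kummerLocalConditionAt (m : ℤ) E) (hy : y ∈ W.kummerLocalConditionAt (m : ℤ) E) :
    descLocalCup W m e hμ hadd₁ hadd₂ hgal E x y = 0 := by
  obtain ⟨y', hy', rfl⟩ := FirstCaseData.exists_local_lift (W := W) (m := m) E hy
  rw [← weilLocalCup_map_inclKD]
  exact weilLocalCup_eq_zero_of_mem_of_fact W m E e hμ hadd₁ hadd₂ hgal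
    (kummerClass_cupProduct_kummerClass_eq_zero_holds E) halt
    (map_inclKD_mem_kummerLocalConditionAt' W E m hx) hy'

/-- **Independence of the local Kummer cocycle** (Milne, *ADT*, I, proof of Prop. 6.9: the pairing does
not depend on the choice of `b_{v,1}` in the image of `A(K_v)`): two data with the same restricted
global cochains `β_{1,v}, β'_v, ε_v` (and any two local Kummer cocycles `κ, κ₂`) have the same local term
when `[β'_v] ∈ 𝓛_E^{(m)}` (`b'` is Selmer) — the cocycles differ by `g₀ ∪_desc β'_v` with
`[g₀], [β'_v] ∈ 𝓛_E^{(m)}`, killed by `inv_E` by the isotropy of the local Kummer condition.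
[cite: MilneADT2006, Ch. I §6, proof of Prop. 6.9] -/
theorem term_eq_of_kummer [W.IsElliptic] [CharZero E] (halt : ∀ T, e T T = 1)
    (invE : galoisCohomology (GaloisRep.restrictField E (mu K (m * m))) 2 →+ ZMod (m * m))
    {D D₂ : GeneralLocalData W m E e hμ hadd₁ hadd₂ hgal}
    (hβ₁ : D.β₁ = D₂.β₁) (hβ' : D.β' = D₂.β') (hε : D.ε = D₂.ε)
    (hmem : locClass _ E D.β' ∈ W.kummerLocalConditionAt (m : ℤ) E) :
    D.term invE = D₂.term invE := by
  rw [term, term, cocycle_eq_add_descCup_kummerDiff hβ₁ hβ' hε, locClass₂_add, map_add, locClass₂_descCup,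
    descLocalCup_eq_zero_of_mem_of_mem halt (locClass_kummerDiff_mem hβ₁) hmem, map_zero, add_zero]

/-! ### The first case: `β₁` a cocycle -/

/-- **The first case** (Milne: "`a ∈ m H¹`", `β_{1,v} - β_{v,1}` is a cocycle and `ε` may be taken to be a
cocycle): if `β_{1,v}` is a `1`-cocycle and `ε_v` a `2`-cocycle, then for every local class
`y₁ ∈ H¹(Γ_E, E[m²])` with `[m]_* y₁ = [β'_v]`,

  `[z_v] = ([β_{1,v}] - [κ]) ∪_{m²} y₁ - [ε_v]`,

the first term being the argument `(res_E b₁ - β) ∪_{m²} β'` of the tree's first-case local term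
`ctLocalTerm` (`CasselsTateLocalTerms.lean`). [cite: MilneADT2006, Ch. I §6, proof of Prop. 6.9] -/
theorem locClass₂_cocycle_of_mem
    (hβ₁ : D.β₁ ∈ contOneCocycles (torsionRepAt W E ((m * m : ℕ) : ℤ)))
    (hεZ : D.ε ∈ contTwoCocycles (muRepAt (K := K) m E))
    (y₁ : galoisCohomology (GaloisRep.restrictField E (W.torsionGaloisModule ((m * m : ℕ) : ℤ))) 1)
    (hy₁ : galoisCohomology.map ((mulK W m m).restrictField E) 1 y₁ = locClass _ E D.β') :
    locClass₂ _ E D.cocycle =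
      weilLocalCup W m E e hμ hadd₁ hadd₂ hgal (locClass _ E ⟨D.β₁, hβ₁⟩ - locClass _ E D.κ) y₁ -
        locClass₂ _ E ⟨D.ε, hεZ⟩ := by
  have h := ContPairing.twoCocycleClass_cupSubCocycle_of_mem
    ((descendPairing W m m e hμ hadd₁ hadd₂ hgal).restrict (absGaloisRestrict K E))
    ⟨D.alpha, D.alpha_mem_of_mem hβ₁⟩ D.β' D.f D.f_eq_dOne_alpha D.ε D.dTwo_ε hεZ
  rw [← D.map_inclKD_locClass_alpha hβ₁, weilLocalCup_map_inclKD, hy₁, descLocalCup_apply]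
  exact h

/-- Hence the local term in the first case: `t_v = inv_E(([β_{1,v}] - [κ]) ∪_{m²} y₁) - inv_E [ε_v]`.
[cite: MilneADT2006, Ch. I §6, proof of Prop. 6.9] -/
theorem term_of_mem (invE : galoisCohomology (GaloisRep.restrictField E (mu K (m * m))) 2 →+ ZMod (m * m))
    (hβ₁ : D.β₁ ∈ contOneCocycles (torsionRepAt W E ((m * m : ℕ) : ℤ)))
    (hεZ : D.ε ∈ contTwoCocycles (muRepAt (K := K) m E))
    (y₁ : galoisCohomology (GaloisRep.restrictField E (W.torsionGaloisModule ((m * m : ℕ) : ℤ))) 1)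
    (hy₁ : galoisCohomology.map ((mulK W m m).restrictField E) 1 y₁ = locClass _ E D.β') :
    D.term invE =
      invE (weilLocalCup W m E e hμ hadd₁ hadd₂ hgal (locClass _ E ⟨D.β₁, hβ₁⟩ - locClass _ E D.κ) y₁) -
        invE (locClass₂ _ E ⟨D.ε, hεZ⟩) := by
  rw [term, D.locClass₂_cocycle_of_mem hβ₁ hεZ y₁ hy₁, map_sub]

/-! ### The divisible second variable: `β' = [m] ∘ β'₁` -/

/-- **Pointwise form of `z_v` along a lift of `β'`**: if `β'_v = [m] ∘ β'₁` for a cocycle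
`β'₁ : Γ_E → E[m²]`, then `z_v(σ, τ) = e_{m²}(β_{1,v} σ - κ σ, σ β'₁ τ) - ε(σ, τ)`
(`desc(S, [m] T̃) = e_{m²}(ι S, T̃)`). [folklore] -/
theorem cocycle_apply_of_lift (β'₁ : contOneCocycles (torsionRepAt W E ((m * m : ℕ) : ℤ)))
    (hβ'₁ : ∀ σ, mulK W m m (β'₁.1 σ) = D.β'.1 σ) (σ τ : absoluteGaloisGroup E) :
    D.cocycle.1 (σ, τ) =
      weilPairingHom W (m * m) e hμ hadd₁ hadd₂ (D.β₁ σ - D.κ.1 σ) (β'₁.1 (σ * τ) - β'₁.1 σ) - D.ε (σ, τ) := by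
  rw [cocycle_apply, descendHom_apply_eq W m m e hμ hadd₁ hadd₂ _ _ (β'₁.1 (σ * τ) - β'₁.1 σ)
    (by rw [map_sub, hβ'₁, hβ'₁]), inclKD_levelDown W m (D.mulK_sub σ)]

/-- **The `2`-cochain `β_{1,v} ∪_{m²} β'₁ - ε_v` equals `z_v + κ ∪_{m²} β'₁`** when `β'_v = [m] ∘ β'₁`
(pointwise), hence is a `2`-cocycle (`d(β₁ ∪ β'₁) = dβ₁ ∪ β'₁ = (ι f) ∪_{m²} β'₁ = f ∪_desc β' = dε`).
Globally this is the cocycle `β₁ ∪ β'₁ - ε ∈ Z²(Γ_K, μ_{m²})` whose localisations compute the pairing with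
a divisible second argument. [cite: MilneADT2006, Ch. I §6, proof of Prop. 6.9] -/
theorem weilCochainCup_sub_eps_eq (β'₁ : contOneCocycles (torsionRepAt W E ((m * m : ℕ) : ℤ)))
    (hβ'₁ : ∀ σ, mulK W m m (β'₁.1 σ) = D.β'.1 σ) :
    weilCochainCup W m E e hμ hadd₁ hadd₂ hgal D.β₁ β'₁ - D.ε =
      (D.cocycle : C(_, _)) + (weilCup W m E e hμ hadd₁ hadd₂ hgal D.κ β'₁ : C(_, _)) := by
  refine ContinuousMap.ext fun p => ?_
  obtain ⟨σ, τ⟩ := p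
  rw [ContinuousMap.sub_apply, ContinuousMap.add_apply, weilCochainCup_apply]
  change _ = D.cocycle.1 (σ, τ) + (weilCup W m E e hμ hadd₁ hadd₂ hgal D.κ β'₁).1 (σ, τ)
  rw [D.cocycle_apply_of_lift β'₁ hβ'₁, weilCup_apply, map_sub (weilPairingHom W (m * m) e hμ hadd₁ hadd₂),
    AddMonoidHom.sub_apply]
  abel

/-- The cocycle property of `β_{1,v} ∪_{m²} β'₁ - ε_v`. [folklore] -/
theorem weilCochainCup_sub_eps_mem (β'₁ : contOneCocycles (torsionRepAt W E ((m * m : ℕ) : ℤ)))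
    (hβ'₁ : ∀ σ, mulK W m m (β'₁.1 σ) = D.β'.1 σ) :
    weilCochainCup W m E e hμ hadd₁ hadd₂ hgal D.β₁ β'₁ - D.ε ∈ contTwoCocycles (muRepAt (K := K) m E) := by
  rw [D.weilCochainCup_sub_eps_eq β'₁ hβ'₁]
  exact add_mem D.cocycle.2 (weilCup W m E e hμ hadd₁ hadd₂ hgal D.κ β'₁).2

/-- **The divisible second variable** (Milne, *ADT*, I, proof of Prop. 6.9 / Lemma 6.17: the value on
`a' ∈ m Ш`): if `β'_v = [m] ∘ β'₁` for a local cocycle `β'₁` at level `m²`, then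

  `[z_v] = [β_{1,v} ∪_{m²} β'₁ - ε_v] - [κ] ∪_{m²} [β'₁]`.

[cite: MilneADT2006, Ch. I §6, proof of Prop. 6.9] -/
theorem locClass₂_cocycle_of_lift_right
    (β'₁ : contOneCocycles (torsionRepAt W E ((m * m : ℕ) : ℤ)))
    (hβ'₁ : ∀ σ, mulK W m m (β'₁.1 σ) = D.β'.1 σ) :
    locClass₂ _ E D.cocycle =
      locClass₂ _ E ⟨_, D.weilCochainCup_sub_eps_mem β'₁ hβ'₁⟩ -
        weilLocalCup W m E e hμ hadd₁ hadd₂ hgal (locClass _ E D.κ) (locClass _ E β'₁) := by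
  rw [← locClass₂_weilCup, ← locClass₂_sub]
  congr 1
  apply Subtype.ext
  change (D.cocycle : C(_, _)) =
    (weilCochainCup W m E e hμ hadd₁ hadd₂ hgal D.β₁ β'₁ - D.ε) - (weilCup W m E e hμ hadd₁ hadd₂ hgal D.κ β'₁ : C(_, _))
  rw [D.weilCochainCup_sub_eps_eq β'₁ hβ'₁, add_sub_cancel_right]

/-- Hence the local term with a divisible second variable and `[β'₁] ∈ 𝓛_E^{(m²)}`:
`t_v = inv_E [β_{1,v} ∪_{m²} β'₁ - ε_v]`, the correction `[κ] ∪_{m²} [β'₁]` being killed by `inv_E` by the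
isotropy of `𝓛_E^{(m²)}`. [cite: MilneADT2006, Ch. I §6, proof of Prop. 6.9] -/
theorem term_of_lift_right [W.IsElliptic] [CharZero E] (halt : ∀ T, e T T = 1)
    (invE : galoisCohomology (GaloisRep.restrictField E (mu K (m * m))) 2 →+ ZMod (m * m))
    (β'₁ : contOneCocycles (torsionRepAt W E ((m * m : ℕ) : ℤ)))
    (hβ'₁ : ∀ σ, mulK W m m (β'₁.1 σ) = D.β'.1 σ)
    (hmem : locClass _ E β'₁ ∈ W.kummerLocalConditionAt ((m * m : ℕ) : ℤ) E) :
    D.term invE = invE (locClass₂ _ E ⟨_, D.weilCochainCup_sub_eps_mem β'₁ hβ'₁⟩) := by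
  rw [term, D.locClass₂_cocycle_of_lift_right β'₁ hβ'₁, map_sub,
    weilLocalCup_eq_zero_of_mem_of_fact W m E e hμ hadd₁ hadd₂ hgal
      (kummerClass_cupProduct_kummerClass_eq_zero_holds E) halt D.κ_mem hmem, map_zero, sub_zero]

end GeneralLocalData

/-! ### Existence of local data -/

/-- **Local data exist** for any restricted global cochains `(β₁, f, β', ε)` satisfying the two identities,
as soon as `[[m] ∘ β₁] ∈ 𝓛_E^{(m)}` (the localisation of the Selmer class `b` satisfies the local Kummer
condition): a local Kummer cocycle `κ` with `[m] ∘ κ = [m] ∘ β₁` exists by `exists_kummerLift`.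
[cite: MilneADT2006, Ch. I §6, proof of Prop. 6.9] -/
theorem exists_generalLocalData [W.IsElliptic]
    (β₁ : C(absoluteGaloisGroup E, torsionRepAt W E ((m * m : ℕ) : ℤ)))
    (β : contOneCocycles (torsionRepAt W E (m : ℤ))) (hβ : ∀ σ, mulK W m m (β₁ σ) = β.1 σ)
    (hβmem : locClass _ E β ∈ W.kummerLocalConditionAt (m : ℤ) E)
    (f : contTwoCocycles (torsionRepAt W E (m : ℤ)))
    (hf : ∀ σ τ : absoluteGaloisGroup E,
      inclKD W m m (f.1 (σ, τ)) = absGaloisRestrict K E σ • β₁ τ - β₁ (σ * τ) + β₁ σ)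
    (β' : contOneCocycles (torsionRepAt W E (m : ℤ)))
    (ε : C(absoluteGaloisGroup E × absoluteGaloisGroup E, muRepAt (K := K) m E))
    (hε : ∀ σ τ υ : absoluteGaloisGroup E,
      (((descendPairing W m m e hμ hadd₁ hadd₂ hgal).restrict (absGaloisRestrict K E)).cupCocycle₂₁
        f β').1 (σ, τ, υ) = dTwo (muRepAt (K := K) m E) ε σ τ υ) :
    ∃ D : GeneralLocalData W m E e hμ hadd₁ hadd₂ hgal, D.β₁ = β₁ ∧ D.f = f ∧ D.β' = β' ∧ D.ε = ε := by
  obtain ⟨κ, hκmem, hκ⟩ := exists_kummerLift W E m β hβmem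
  exact ⟨{ β₁ := β₁, f := f, inclKD_f := hf, β' := β', ε := ε, dTwo_ε := hε, κ := κ, κ_mem := hκmem
           mulK_κ := fun σ => by rw [hκ, hβ] }, rfl, rfl, rfl, rfl⟩

end Local

end Literature.NumberTheory.EllipticCurves

end
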